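import Literature.Probability.RandomPlanarGeometry.LoewnerRegularBoxes
import Literature.Probability.RandomPlanarGeometry.CrossingCondition
import HarnessLib

/-!
# Kemppainen–Smirnov's main theorem, probabilistic half: Condition G2 gives tight Loewner regularity

Topic `Literature/Probability/RandomPlanarGeometry` (family `crit-ising`). ONE named fact and
its proved corollaries. The tree has the DETERMINISTIC half of

* A. Kemppainen, S. Smirnov, *Random curves, scaling limits and Loewner evolutions*, Ann. Probab.
  45 (2017) 698–779 (arXiv:1212.6215): Thm. 1.5 (arXiv Thm. 1.3), Cor. 1.7–1.8 (arXiv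
  Cor. 1.5–1.6), §3.1 Prop. 3.2, §3.3 Prop. 3.7–3.8 and Thm. 3.9, §3.4 Thm. 3.10, §3.5,

as theorems: the event form `regularCurves φ 𝔯` of KS's event `E = ⋂ₖ Eₖ ∩ X_simple` with a
uniform transience index (`LoewnerRegularCurves.lean`: Lemmas A.4, A.5, A.7 and "the rest of
the claims follow from Lemma A.5"), its inclusion in the compact boxes of Loewner pairs
(`LoewnerRegularBoxes.lean`, `exists_pairBox_of_regularCurves`), and the passage to weak limits
and to driving-process convergence in a fixed or in approximating domains
(`ae_isLoewnerDescribable_and_tendstoInDistribution_of_regularCurves(_varying)`,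
`…_drivingPath_varying`). What it does NOT have is the PROBABILISTIC half, §3.5 first paragraph:
"Fix `ε > 0`. We will first choose four events `E_k`, `k = 1, 2, 3, 4`, that have large
probability, namely `P(E_k) ≥ 1 - ε/4` for all `P ∈ Σ_𝔻` … using Proposition 3.8 [`E₁`,
capacity], Proposition 3.2 [`N₀` tight: uniform transience; `E₂`] and Theorem 3.9 [`E₃`:
Hölder driving term], … Theorem 3.10 [`E₄`: continuity of the hyperbolic geodesic to the tip]"
— all four from Condition G2 alone (Prop. 3.2: "If `Σ` satisfies Condition G2 … then `N₀`,
`C_{1,α}`, `C_{2,α',T}`, `C_{3,ψ,T,R}` are tight in `Σ_𝔻`"). Every FK-Ising / spin-Ising /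
percolation route of the tree takes exactly this output as a hypothesis ("lattice data", item 2
of `LatticeModels.exists_observableMartingale_fkInterface_of_latticeData`; `IsKSRegularAlongMesh`
of `LatticeFlowLinePassage.lean`). This file records it as the named fact

* `exists_regularity_of_conditionG2` — for Dobrushin domains `(D_n; a_n, b_n) → (D; a, b)` with
  chordal uniformizing maps whose boundary extensions converge ((U1), (U2), `b_n → b`: the
  setting of KS Cor. 1.8 / CDHKS §3, in the tree's form) and probability laws `μ_n` carried by
  SIMPLE chordal curves of `(D_n; a_n, b_n)`, Condition G2 for the collection
  `Σ = {(D_n, a_n, b_n, μ_n)}` implies: for every `ε > 0` ONE regularity `𝔯` with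
  `μ_n (regularCurves (φ_n) 𝔯)ᶜ ≤ ε` for all `n`;

and PROVES from it the two consumable forms: `exists_pairBox_of_conditionG2` (KS box tightness
of the pull-backs through the `φ_n`, the hypothesis `h` of
`ae_isLoewnerDescribable_and_tendstoInDistribution_drivingPath_varying`) and
`ae_isLoewnerDescribable_and_tendstoInDistribution_of_conditionG2` (KS Thm. 1.5 (ii)–(iii) with
Cor. 1.7–1.8: a.e. describability of weak limits and convergence in law of the discrete driving
processes).

## Faithfulness notes (read before discharging or consuming)

1. APPROXIMATING DOMAINS. KS state Prop. 3.2 / Thms. 3.9–3.10 for the push-forward collection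
   `Σ_𝔻` on the unit disc (through ANY conformal `φ : U → 𝔻` with `a ↦ -1`, `b ↦ +1`; the
   conditions are conformally invariant, Prop. 2.6) and the driving terms in `ℍ` through the fixed
   map `Φ(z) = i(1+z)/(1-z)`; with `φ_n : ℍ → D_n` chordal, `Φ⁻¹ ∘ φ_n⁻¹` is such a map, so the
   tree's `drivingFunction (φ_n)` IS KS's driving term. The clauses of `IsRegularCurve` that are
   Euclidean in `D_n` around `b_n` (transience radii, capacity schedule, localisation of the tip
   modulus) are KS's clauses, Euclidean in `𝔻` around `+1`, transported through the boundary
   extensions `Φ_n`; the transport is uniform in `n` exactly when the `Φ_n` are uniformly proper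
   and uniformly small at infinity, which the tree PROVES from (U1), (U2), `b_n → b`
   (`exists_forall_le_dist_boundaryExtension_of_varying`,
   `exists_forall_dist_boundaryExtension_lt_of_varying`, `LoewnerRegularBoxes.lean`). Hence the
   hypotheses (U1), (U2), `hb` in the fact (KS Cor. 1.8 asks only for Carathéodory convergence;
   the stronger form is what the tree's consumers have anyway).
2. STOPPING TIMES. The tree's `ConditionG2` quantifies over first hitting times of closed sets
   (KS Lemma 2.1) instead of all stopping times; by KS Remark 2.2 these are the only stopping
   times used in the proofs of Prop. 3.2, 3.7, 3.11 and Thm. 3.10. The fact leans on that remark.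
3. SUPPORT. KS assume `P` carried by `X_simple(U, a, b)` (§1.1: simple curves in `Ū` from `a` to
   `b` with `γ(0,1) ⊆ U`); here this is the a.e. clause `hsupp`, together with the divergence of
   the height of the pull-back at `b_n` (`tendsto_im`, the tree's input of Lawler's Prop. 4.4 in
   `SimpleCurveLoewner.lean`, a clause of `IsRegularCurve`; automatic for lattice curves entering
   `b_n` along a segment across a straight piece of `∂D_n`,
   `MarkedDomain.IsChordalUniformizing.tendsto_im_symm_IccExtend_atTop_of_segment`).
4. NOT COVERED: laws of NON-simple lattice curves. The raw medial exploration polyline of bond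
   percolation / FK on `ℤ²` touches itself at doubly visited medial vertices; KS §4.1.2 pass to
   the modified medial lattice precisely to work with simple, `2η`-separated discrete curves
   (§4.1.4), for which Condition G2 below the mesh scale is void. For a raw self-touching
   polyline the tree's literal `ConditionG2` fails at sub-mesh scales (the second visit of a
   medial vertex is an unforced crossing of small annuli about it that is certain given the
   past), and `regularCurves` (injective curves) does not contain its class; such curves need a
   separate transfer statement, not this fact.
5. `E₂` (Hölder parametrisations of the curves, Aizenman–Burchard) is not a clause of
   `IsRegularCurve` and is not asserted.

## References

* A. Kemppainen, S. Smirnov, Ann. Probab. 45 (2017) 698–779: Thm. 1.5, Cor. 1.7, Cor. 1.8,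
  Remark 2.2, Prop. 2.6, §3.1 Prop. 3.2, §3.3 Prop. 3.8 and Thm. 3.9, §3.4 Thm. 3.10, §3.5,
  §4.1.2–4.1.4 (arXiv:1212.6215: Thm. 1.3, Cor. 1.5–1.6, Prop. 3.2, Prop. 3.8, Thm. 3.9,
  Thm. 3.10, §3.5). [KemppainenSmirnov2017]
* D. Chelkak, H. Duminil-Copin, C. Hongler, A. Kemppainen, S. Smirnov, C. R. Math. Acad. Sci.
  Paris 352 (2014) 157–161, Thm. 3 and §3. [CDHKSCRAS2014]
-/

noncomputable section

open MeasureTheory Filter Topology Set Metric Function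
open UpperHalfPlane (upperHalfPlaneSet)
open scoped NNReal ENNReal BoundedContinuousFunction unitInterval

namespace Literature.Probability.RandomPlanarGeometry

open scoped PathBorel

/-! ### The named fact -/

/-- **Kemppainen–Smirnov: Condition G2 gives tight Loewner regularity, uniformly over a family of
curve laws in approximating domains** (Ann. Probab. 45 (2017): Prop. 3.2 with Prop. 3.8,
Thm. 3.9, Thm. 3.10, assembled as in §3.5, first paragraph of the proof of Thm. 1.5; read in
approximating domains as in Cor. 1.8). Let `(D_n; a_n, b_n)`, `(D; a, b)` be Dobrushin domains
with chordal uniformizing maps `φ_n`, `φ` whose boundary extensions converge uniformly on the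
compacts `{0 ≤ im} ∩ closedBall 0 R` ((U1)) and uniformly at infinity ((U2)), with `b_n → b`.
Let `μ_n` be probability laws on curve classes, each carried by SIMPLE chordal curves of
`(D_n; a_n, b_n)` — `c 0 = a_n`, `c 1 = b_n`, `c(0, 1) ⊆ D_n`, `c` injective on `(0, 1)` — whose
pull-backs through `φ_n` have diverging height at `b_n` (KS's support hypothesis
`X_simple(D_n, a_n, b_n)`, with the tree's form of the input of Lawler's Prop. 4.4). If the
collection `Σ = {(D_n, a_n, b_n, μ_n) : n ∈ ℕ}` satisfies Condition G2 (`ConditionG2`, KS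
§2.1.3 eq. (16), at the first hitting times of closed sets — KS Lemma 2.1, Remark 2.2), then for
every `ε > 0` there is ONE regularity datum `𝔯` (transience radii and index at `b_n` — Prop. 3.2
(i), `N₀` tight; capacity schedule — Prop. 3.8 (1), `E₁`; moduli of the Loewner transforms on
each `[0, T]` — Thm. 3.9, `E₃`; localised moduli of the hyperbolic geodesic to the tip —
Thm. 3.10, `E₄`) such that `μ_n (regularCurves (φ_n) 𝔯)ᶜ ≤ ε` for ALL `n`: the curves are,
with probability `≥ 1 - ε` at every scale, regular simple chordal curves of `(D_n; a_n, b_n)`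
with the common parameters `𝔯` (`LoewnerRegularCurves.lean`). The Euclidean clauses around `b_n`
are KS's clauses around `+1 ∈ ∂𝔻` transported through the boundary extensions, uniformly in `n`
by (U1), (U2), `b_n → b` (module docstring, note 1); the fact leans on KS Remark 2.2 for the
restriction to hitting times (note 2) and says nothing about non-simple lattice curves (note 4).
[cite: KemppainenSmirnov2017, Thm. 1.5, Prop. 3.2, Prop. 3.8, Thm. 3.9, Thm. 3.10, §3.5 and Cor. 1.8] -/
def exists_regularity_of_conditionG2 : Prop :=
  ∀ {D : DobrushinDomain} {φ : ConformalEquiv upperHalfPlaneSet D.carrier}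
    {Ds : ℕ → DobrushinDomain} {φs : ∀ n, ConformalEquiv upperHalfPlaneSet (Ds n).carrier},
    D.IsChordalUniformizing φ → (∀ n, (Ds n).IsChordalUniformizing (φs n)) →
    (∀ R : ℝ, TendstoUniformlyOn (fun n ↦ (φs n).boundaryExtension) φ.boundaryExtension atTop
      ({z : ℂ | 0 ≤ z.im} ∩ closedBall 0 R)) →
    (∀ ε : ℝ, 0 < ε → ∃ r : ℝ, ∀ᶠ n in atTop, ∀ z : ℂ, z ∈ {z : ℂ | 0 ≤ z.im} → r ≤ ‖z‖ →
      dist ((φs n).boundaryExtension z) ((Ds n).pt 1) ≤ ε) →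
    Tendsto (fun n ↦ (Ds n).pt 1) atTop (𝓝 (D.pt 1)) →
    ∀ (μs : ℕ → Measure (CurveClass ℂ)), (∀ n, IsProbabilityMeasure (μs n)) →
    (∀ n, ∀ᵐ x ∂μs n, ∃ c : Curve ℂ, CurveClass.mk c = x ∧ c 0 = (Ds n).pt 0 ∧
      c 1 = (Ds n).pt 1 ∧ (∀ s : I, 0 < (s : ℝ) → (s : ℝ) < 1 → c s ∈ (Ds n).carrier) ∧
      InjOn c {s : I | 0 < (s : ℝ) ∧ (s : ℝ) < 1} ∧
      Tendsto (fun u : ℝ ↦ ((φs n).symm (IccExtend zero_le_one c u)).im) (𝓝[<] 1) atTop) →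
    ConditionG2 (Set.range fun n : ℕ ↦
      (⟨(Ds n).carrier, (Ds n).pt 0, (Ds n).pt 1, μs n⟩ : MarkedLaw)) →
    ∀ ε : ℝ≥0∞, 0 < ε → ∃ 𝔯 : LoewnerRegularity, ∀ n, μs n (regularCurves (φs n) 𝔯)ᶜ ≤ ε

/-! ### Consumable forms (proved from the fact) -/

variable {D : DobrushinDomain} {φ : ConformalEquiv upperHalfPlaneSet D.carrier}
  {Ds : ℕ → DobrushinDomain} {φs : ∀ n, ConformalEquiv upperHalfPlaneSet (Ds n).carrier}

/-- **Box tightness from Condition G2** (KS Prop. 3.2 with Thms. 3.9–3.10 in the box form of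
`LoewnerTransformContinuity.lean` / `DrivingProcessWeakLimitVarying.lean`): given the named fact
`exists_regularity_of_conditionG2`, under its hypotheses, for every `ε > 0` there are moduli
`δγ, δW > 0` and a transience profile `T` such that for ALL `n`, with `μ_n`-probability
`≥ 1 - ε` the curve class is `⟦Φ_n ∘ γ̂⟧` for a Loewner pair `(γ̂, W)` (trace and transform
through `φ_n`) with `γ̂ 0 = W 0 = 0`, the moduli `δγ`, `δW` on every `[0, k + 1]` and
`‖γ̂ t‖ ≥ k` for `t ≥ T k` — literally the hypothesis `h` of
`ae_isLoewnerDescribable_and_tendstoInDistribution_drivingPath_varying` and the box clause of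
the lattice-data hypotheses of the FK-Ising / percolation routes. PROVED from the fact by
`exists_pairBox_of_regularCurves` with the uniform properness and uniform smallness at infinity
of the `Φ_n` (`exists_forall_le_dist_boundaryExtension_of_varying`,
`exists_forall_dist_boundaryExtension_lt_of_varying`).
[cite: KemppainenSmirnov2017, Prop. 3.2, Thm. 3.9, Thm. 3.10 and §3.5] -/
theorem exists_pairBox_of_conditionG2 (hKS : exists_regularity_of_conditionG2)
    (hφ : D.IsChordalUniformizing φ) (hφs : ∀ n, (Ds n).IsChordalUniformizing (φs n))
    (hU1 : ∀ R : ℝ, TendstoUniformlyOn (fun n ↦ (φs n).boundaryExtension) φ.boundaryExtension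
      atTop ({z : ℂ | 0 ≤ z.im} ∩ closedBall 0 R))
    (hU2 : ∀ ε : ℝ, 0 < ε → ∃ r : ℝ, ∀ᶠ n in atTop, ∀ z : ℂ, z ∈ {z : ℂ | 0 ≤ z.im} → r ≤ ‖z‖ →
      dist ((φs n).boundaryExtension z) ((Ds n).pt 1) ≤ ε)
    (hb : Tendsto (fun n ↦ (Ds n).pt 1) atTop (𝓝 (D.pt 1)))
    {μs : ℕ → Measure (CurveClass ℂ)} [hμs : ∀ n, IsProbabilityMeasure (μs n)]
    (hsupp : ∀ n, ∀ᵐ x ∂μs n, ∃ c : Curve ℂ, CurveClass.mk c = x ∧ c 0 = (Ds n).pt 0 ∧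
      c 1 = (Ds n).pt 1 ∧ (∀ s : I, 0 < (s : ℝ) → (s : ℝ) < 1 → c s ∈ (Ds n).carrier) ∧
      InjOn c {s : I | 0 < (s : ℝ) ∧ (s : ℝ) < 1} ∧
      Tendsto (fun u : ℝ ↦ ((φs n).symm (IccExtend zero_le_one c u)).im) (𝓝[<] 1) atTop)
    (hG2 : ConditionG2 (Set.range fun n : ℕ ↦
      (⟨(Ds n).carrier, (Ds n).pt 0, (Ds n).pt 1, μs n⟩ : MarkedLaw))) :
    ∀ ε : ℝ≥0∞, 0 < ε → ∃ (δγ δW : ℕ → ℝ) (T : ℕ → ℝ≥0), (∀ k, 0 < δγ k) ∧ (∀ k, 0 < δW k) ∧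
      ∀ n, μs n ((fun p ↦ compactifiedClass (φs n).boundaryExtension ((Ds n).pt 1) p.1) ''
        {p : C(ℝ≥0, ℂ) × C(ℝ≥0, ℝ) | p ∈ generatedPairs ∧
          p.1 ∈ Process.modulusSet ({0} : Set ℂ) δγ ∧ p.2 ∈ Process.modulusSet ({0} : Set ℝ) δW ∧
          ∀ (k : ℕ) (t : ℝ≥0), T k ≤ t → (k : ℝ) ≤ ‖p.1 t‖})ᶜ ≤ ε := by
  have hinf := fun ρ (hρ : (0 : ℝ) < ρ) ↦
    exists_forall_dist_boundaryExtension_lt_of_varying hφs hU2 hρ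
  have hprop := exists_forall_le_dist_boundaryExtension_of_varying hφ hφs hU1 hb
  intro ε hε
  obtain ⟨𝔯, h𝔯⟩ := hKS hφ hφs hU1 hU2 hb μs hμs hsupp hG2 ε hε
  obtain ⟨δγ, δW, T, hδγ, hδW, hbox⟩ := exists_pairBox_of_regularCurves hφs hinf hprop 𝔯
  exact ⟨δγ, δW, T, hδγ, hδW, fun n ↦
    (measure_mono (compl_subset_compl.2 (hbox n))).trans (h𝔯 n)⟩

/-- **Kemppainen–Smirnov's Thm. 1.5 (ii)–(iii) with Cor. 1.7–1.8 from Condition G2, in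
approximating domains**: given the named fact `exists_regularity_of_conditionG2`, under its
hypotheses and for a weak limit `μ_n → ν`, `ν`-a.e. curve class is described by the Loewner
evolution through `φ`, and the discrete driving processes `drivingFunction (φ_n)` under `μ_n`
(CDHKS's `w^δ`, Thm. 3) converge in distribution on `C([0, ∞), ℝ)` to the driving function
through `φ` under `ν`. PROVED from the fact by
`ae_isLoewnerDescribable_and_tendstoInDistribution_of_regularCurves_varying`.
[cite: KemppainenSmirnov2017, Thm. 1.5, Cor. 1.7 and Cor. 1.8] [cite: CDHKSCRAS2014, Thm. 3 and §3] -/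
theorem ae_isLoewnerDescribable_and_tendstoInDistribution_of_conditionG2
    (hKS : exists_regularity_of_conditionG2)
    (hφ : D.IsChordalUniformizing φ) (hφs : ∀ n, (Ds n).IsChordalUniformizing (φs n))
    (hU1 : ∀ R : ℝ, TendstoUniformlyOn (fun n ↦ (φs n).boundaryExtension) φ.boundaryExtension
      atTop ({z : ℂ | 0 ≤ z.im} ∩ closedBall 0 R))
    (hU2 : ∀ ε : ℝ, 0 < ε → ∃ r : ℝ, ∀ᶠ n in atTop, ∀ z : ℂ, z ∈ {z : ℂ | 0 ≤ z.im} → r ≤ ‖z‖ →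
      dist ((φs n).boundaryExtension z) ((Ds n).pt 1) ≤ ε)
    (hb : Tendsto (fun n ↦ (Ds n).pt 1) atTop (𝓝 (D.pt 1)))
    {μs : ℕ → Measure (CurveClass ℂ)} [hμs : ∀ n, IsProbabilityMeasure (μs n)]
    {ν : Measure (CurveClass ℂ)} [IsProbabilityMeasure ν]
    (hlim : ∀ f : CurveClass ℂ →ᵇ ℝ, Tendsto (fun n ↦ ∫ c, f c ∂μs n) atTop (𝓝 (∫ c, f c ∂ν)))
    (hsupp : ∀ n, ∀ᵐ x ∂μs n, ∃ c : Curve ℂ, CurveClass.mk c = x ∧ c 0 = (Ds n).pt 0 ∧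
      c 1 = (Ds n).pt 1 ∧ (∀ s : I, 0 < (s : ℝ) → (s : ℝ) < 1 → c s ∈ (Ds n).carrier) ∧
      InjOn c {s : I | 0 < (s : ℝ) ∧ (s : ℝ) < 1} ∧
      Tendsto (fun u : ℝ ↦ ((φs n).symm (IccExtend zero_le_one c u)).im) (𝓝[<] 1) atTop)
    (hG2 : ConditionG2 (Set.range fun n : ℕ ↦
      (⟨(Ds n).carrier, (Ds n).pt 0, (Ds n).pt 1, μs n⟩ : MarkedLaw))) :
    (∀ᵐ c ∂ν, IsLoewnerDescribable φ c) ∧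
      TendstoInDistribution
        (fun (n : ℕ) (c : CurveClass ℂ) ↦
          (⟨fun u ↦ drivingFunction (φs n) c u, continuous_drivingFunction (φs n) c⟩ : C(ℝ≥0, ℝ)))
        atTop (fun c ↦ (⟨drivingFunction φ c, continuous_drivingFunction φ c⟩ : C(ℝ≥0, ℝ))) μs ν :=
  ae_isLoewnerDescribable_and_tendstoInDistribution_of_regularCurves_varying hφ hφs hU1 hU2 hb
    hlim (hKS hφ hφs hU1 hU2 hb μs hμs hsupp hG2)

end Literature.Probability.RandomPlanarGeometry
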